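import Summits.CriticalPhenomena.Ising3DConformalLimit.Theses.OctantEntropy
import Literature.Probability.LatticeModels.RandomCurrentsProofs
import Literature.Probability.LatticeModels.DoubleCurrents
import Literature.Probability.LatticeModels.IsingThermodynamics
import HarnessLib

/-!
# The exact first-moment (switching) identity for the sourced double-current cluster:
# item `SwitchingFirstMoment` (stmt-CriticalPhenomena-11355) of route `OctantEntropy`

For `2^(K+1) ≤ L`, `o = 0`, `y = 2^(K+1) e₁` in the free box graph `freeBoxGraph 3 L` of
`Λ_L ⊂ ℤ³` at `β = β_c(3)`, and the dyadic window `W_K = [−2^K, 2^K)³`,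

  `E_{P^{{o,y},∅}_{Λ_L,β}} [#(C_{n₁+n₂}(o) ∩ W_K)] = ∑_{u ∈ W_K} ⟨σ_oσ_u⟩⟨σ_uσ_y⟩ / ⟨σ_oσ_y⟩`

(finite-volume free two-point functions of the box graph), where `P^{A,B}` is the tree's
`doubleCurrentMeasure`. This is the probabilistic reading of the switching lemma
(Aizenman 1982, §3; Aizenman–Duminil-Copin 2021, Prop. A.3, first display:
`P^{0x,∅}[u ↔ 0] = ⟨σ₀σ_u⟩⟨σ_uσ_x⟩/⟨σ₀σ_x⟩`).

Contents.
* `doubleCurrentMeasure_eq_zero_of_currentSum_eq_zero` — the junk value: a vanishing source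
  normaliser gives the zero measure;
* `doubleCurrentMeasure_real_tracedConn_eq` — on ANY finite graph, `β ≥ 0`, `Z[{o}∆{y}] ≠ 0`:
  `P^{{o}∆{y},∅}[o ↔ u] = ⟨σ_oσ_u⟩⟨σ_uσ_y⟩/⟨σ_oσ_y⟩` (switching with `A = {y} ∆ {u}` and the pair
  `(o,u)`: `Z[yu] Z[ou] = Z[oy] Z[∅] · P^{{o}∆{y},∅}[o ↔ u]`, then `⟨σ_aσ_b⟩ = Z[ab]/Z[∅]`);
* `integral_card_filter_tracedConn_eq_sum` — on ANY finite graph, `β ≥ 0`, any finite `W`: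
  `E_{P^{{o}∆{y},∅}}[#{u ∈ W : o ↔ u}] = ∑_{u ∈ W} ⟨σ_oσ_u⟩⟨σ_uσ_y⟩/⟨σ_oσ_y⟩` (linearity over the
  indicators; the degenerate case `Z[oy] = 0` holds with both sides `0`: the measure is the junk
  value `0` and `x / 0 = 0`);
* `switchingFirstMoment_proof` — the item, verbatim (the route's inlined graph is
  `freeBoxGraph 3 L` definitionally; the source filter is `{o} ∆ {y}` since `o ≠ y`).

Theorem-only file. References: M. Aizenman, Comm. Math. Phys. 86 (1982), §3 [AizenmanCMP1982];
R. B. Griffiths, C. A. Hurst, S. Sherman, J. Math. Phys. 11 (1970) [GriffithsHurstSherman1970];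
H. Duminil-Copin, arXiv:1607.06933 (2016), Lemma 2.2 [DuminilCopin2016];
M. Aizenman, H. Duminil-Copin, Ann. of Math. 194 (2021), Prop. A.3 [AizenmanDuminilCopinAnnals2021].
-/

noncomputable section

open MeasureTheory Finset
open scoped symmDiff Classical
open Literature.Probability.LatticeModels

namespace Summit.CriticalPhenomena.Ising3DConformalLimit.Theorems

section General

variable {V : Type*} [Fintype V] [DecidableEq V] (G : SimpleGraph V) [DecidableRel G.Adj]

/-- The double-current measure with a vanishing source normaliser is the junk value `0`.
[folklore] -/
theorem doubleCurrentMeasure_eq_zero_of_currentSum_eq_zero (β : ℝ) {A : Finset V} (B : Finset V)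
    (hA : currentSum G β A = 0) : doubleCurrentMeasure G β A B = 0 := by
  simp [doubleCurrentMeasure, hA]

/-- **The one-site density of the sourced double-current cluster** (switching lemma, probabilistic
form): on a finite graph, for `β ≥ 0` and `Z[{o}∆{y}] ≠ 0`,
`P^{{o}∆{y},∅}[o ↔ u in n₁+n₂] = ⟨σ_oσ_u⟩⟨σ_uσ_y⟩/⟨σ_oσ_y⟩` (free two-point functions of `G`).
[cite: AizenmanDuminilCopinAnnals2021, Appendix A.2, Proposition A.3 (first display)] -/
theorem doubleCurrentMeasure_real_tracedConn_eq {β : ℝ} (hβ : 0 ≤ β) (o y u : V)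
    (hZ : currentSum G β ({o} ∆ {y}) ≠ 0) :
    (doubleCurrentMeasure G β ({o} ∆ {y}) ∅).real (tracedConn G o u) =
      isingTwoPoint G univ β 0 .free o u * isingTwoPoint G univ β 0 .free u y /
        isingTwoPoint G univ β 0 .free o y := by
  have hZ0 : 0 < currentSum G β ∅ := currentSum_empty_pos' G β
  have hG : ∀ a b : V, isingTwoPoint G univ β 0 .free a b =
      currentSum G β ({a} ∆ {b}) / currentSum G β ∅ :=
    isingTwoPoint_free_eq_currentSum_div_holds G β
  have hsw := currentSum_mul_currentSum_pair_holds G hβ ({y} ∆ {u}) o u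
  have hA : ({y} ∆ {u}) ∆ ({o} ∆ {u}) = (({o} : Finset V) ∆ {y}) := by
    rw [symmDiff_comm ({o} : Finset V) {u}, symmDiff_assoc, symmDiff_symmDiff_cancel_left,
      symmDiff_comm]
  rw [hA] at hsw
  have hden : currentSum G β ({o} ∆ {y}) * currentSum G β ∅ ≠ 0 := mul_ne_zero hZ hZ0.ne'
  have hP : (doubleCurrentMeasure G β ({o} ∆ {y}) ∅).real (tracedConn G o u) =
      currentSum G β ({y} ∆ {u}) * currentSum G β ({o} ∆ {u}) /
        (currentSum G β ({o} ∆ {y}) * currentSum G β ∅) := by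
    rw [eq_div_iff hden, hsw]
    ring
  rw [hP, hG o u, hG u y, hG o y, symmDiff_comm ({u} : Finset V) {y}]
  field_simp

/-- **First moment of the one-arm count of the sourced double-current cluster** (switching lemma,
summed): on a finite graph, for `β ≥ 0`, vertices `o, y` and a finite set `W`,
`E_{P^{{o}∆{y},∅}}[#{u ∈ W : o ↔ u in n₁+n₂}] = ∑_{u ∈ W} ⟨σ_oσ_u⟩⟨σ_uσ_y⟩/⟨σ_oσ_y⟩`; if
`Z[{o}∆{y}] = 0` both sides vanish (junk measure `0`, `x / 0 = 0`).
[cite: AizenmanDuminilCopinAnnals2021, Appendix A.2, Proposition A.3 (first display)] -/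
theorem integral_card_filter_tracedConn_eq_sum {β : ℝ} (hβ : 0 ≤ β) (o y : V) (W : Finset V) :
    ∫ p, ((W.filter fun u => p ∈ tracedConn G o u).card : ℝ) ∂(doubleCurrentMeasure G β ({o} ∆ {y}) ∅) =
      ∑ u ∈ W, isingTwoPoint G univ β 0 .free o u * isingTwoPoint G univ β 0 .free u y /
        isingTwoPoint G univ β 0 .free o y := by
  -- the integrand as a finite sum of indicators
  have hcard : ∀ p : Current G × Current G,
      ((W.filter fun u => p ∈ tracedConn G o u).card : ℝ) =
        ∑ u ∈ W, (tracedConn G o u).indicator 1 p := by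
    intro p
    rw [Finset.natCast_card_filter]
    refine Finset.sum_congr rfl fun u _ => ?_
    by_cases h2 : p ∈ tracedConn G o u
    · rw [if_pos h2, Set.indicator_of_mem h2, Pi.one_apply]
    · rw [if_neg h2, Set.indicator_of_notMem h2]
  simp_rw [hcard]
  have hZ0 : 0 < currentSum G β ∅ := currentSum_empty_pos' G β
  by_cases hZ : currentSum G β ({o} ∆ {y}) = 0
  · -- degenerate normaliser: both sides vanish
    rw [doubleCurrentMeasure_eq_zero_of_currentSum_eq_zero G β ∅ hZ, integral_zero_measure]
    symm
    refine Finset.sum_eq_zero fun u _ => ?_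
    rw [isingTwoPoint_free_eq_currentSum_div_holds G β o y, hZ, zero_div, div_zero]
  · -- nondegenerate: a probability measure; switching term by term
    haveI : IsProbabilityMeasure (doubleCurrentMeasure G β ({o} ∆ {y}) ∅) :=
      isProbabilityMeasure_doubleCurrentMeasure_holds G hβ hZ hZ0.ne'
    rw [integral_finsetSum W fun u _ => ?_]
    · refine Finset.sum_congr rfl fun u _ => ?_
      rw [integral_indicator_one (measurableSet_tracedConn G o u)]
      exact doubleCurrentMeasure_real_tracedConn_eq G hβ o y u hZ
    · exact (integrable_const (1 : ℝ)).indicator (measurableSet_tracedConn G o u)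

end General

/-- **Item `SwitchingFirstMoment` (stmt-CriticalPhenomena-11355), verbatim**: the exact
first-moment identity `E_{P^{{o,y},∅}_{Λ_L,β_c}}[#(C_{n₁+n₂}(o) ∩ W_K)] =
∑_{u ∈ W_K} ⟨σ_oσ_u⟩⟨σ_uσ_y⟩/⟨σ_oσ_y⟩` for the sourced critical double current of the free box
graph of `Λ_L ⊂ ℤ³` (switching lemma, Aizenman 1982 §3; ADC21 Prop. A.3, first display).
[cite: AizenmanDuminilCopinAnnals2021, Appendix A.2, Proposition A.3 (first display)] -/
theorem switchingFirstMoment_proof :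
    Summit.CriticalPhenomena.Ising3DConformalLimit.Theses.OctantEntropy.SwitchingFirstMoment := by
  unfold Summit.CriticalPhenomena.Ising3DConformalLimit.Theses.OctantEntropy.SwitchingFirstMoment
  intro K L _hKL o y ho hy
  -- the route's inlined graph is `freeBoxGraph 3 L` (definitionally)
  change ∫ p, ((Finset.univ.filter fun u : BoxVertex 3 L =>
      (∀ i, -(2 ^ K : ℤ) ≤ (u : Site 3) i ∧ (u : Site 3) i < 2 ^ K) ∧
        p ∈ tracedConn (freeBoxGraph 3 L) ⟨0, zero_mem_box 3 (L + 1)⟩ u).card : ℝ)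
      ∂(doubleCurrentMeasure (freeBoxGraph 3 L) (criticalBeta 3)
        (Finset.univ.filter fun v : BoxVertex 3 L =>
          (v : Site 3) = 0 ∨ (v : Site 3) = Pi.single 0 (2 ^ (K + 1))) ∅) =
    ∑ u ∈ Finset.univ.filter (fun u : BoxVertex 3 L =>
        ∀ i, -(2 ^ K : ℤ) ≤ (u : Site 3) i ∧ (u : Site 3) i < 2 ^ K),
      isingTwoPoint (freeBoxGraph 3 L) Finset.univ (criticalBeta 3) 0 BoundaryCondition.free o u *
        isingTwoPoint (freeBoxGraph 3 L) Finset.univ (criticalBeta 3) 0 BoundaryCondition.free u y /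
        isingTwoPoint (freeBoxGraph 3 L) Finset.univ (criticalBeta 3) 0 BoundaryCondition.free o y
  -- the two sources are distinct, and the source set is `{o} ∆ {y}`
  have hoy : o ≠ y := by
    intro h
    have h0 := congrArg (fun v : BoxVertex 3 L => (v : Site 3) 0) h
    simp only [ho, hy, Pi.zero_apply, Pi.single_eq_same] at h0
    exact (pow_pos (by norm_num : (0 : ℤ) < 2) (K + 1)).ne h0
  have hS : (Finset.univ.filter fun v : BoxVertex 3 L =>
      (v : Site 3) = 0 ∨ (v : Site 3) = Pi.single 0 (2 ^ (K + 1))) = {o} ∆ {y} := by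
    ext v
    rw [Finset.mem_filter, Finset.mem_symmDiff, Finset.mem_singleton, Finset.mem_singleton, ← ho,
      ← hy, Subtype.val_inj, Subtype.val_inj]
    constructor
    · rintro ⟨-, rfl | rfl⟩
      · exact Or.inl ⟨rfl, hoy⟩
      · exact Or.inr ⟨rfl, fun h => hoy h.symm⟩
    · rintro (⟨h, -⟩ | ⟨h, -⟩)
      · exact ⟨Finset.mem_univ _, Or.inl h⟩
      · exact ⟨Finset.mem_univ _, Or.inr h⟩
  have ho' : (⟨0, zero_mem_box 3 (L + 1)⟩ : BoxVertex 3 L) = o := Subtype.ext ho.symm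
  rw [ho', hS]
  -- `{u | u ∈ W_K ∧ o ↔ u} = {u ∈ W_K | o ↔ u}`
  have hfun : (fun p : Current (freeBoxGraph 3 L) × Current (freeBoxGraph 3 L) =>
      ((Finset.univ.filter fun u : BoxVertex 3 L =>
        (∀ i, -(2 ^ K : ℤ) ≤ (u : Site 3) i ∧ (u : Site 3) i < 2 ^ K) ∧
          p ∈ tracedConn (freeBoxGraph 3 L) o u).card : ℝ)) =
      fun p => (((Finset.univ.filter fun u : BoxVertex 3 L =>
        ∀ i, -(2 ^ K : ℤ) ≤ (u : Site 3) i ∧ (u : Site 3) i < 2 ^ K).filter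
          fun u => p ∈ tracedConn (freeBoxGraph 3 L) o u).card : ℝ) := by
    funext p
    rw [Finset.filter_filter]
  rw [hfun]
  exact integral_card_filter_tracedConn_eq_sum (freeBoxGraph 3 L) (criticalBeta_nonneg 3) o y _

end Summit.CriticalPhenomena.Ising3DConformalLimit.Theorems

end
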